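import Mathlib
import Summits.ABC.IUTFork.Joshi.LocalPeriodRings
import Summits.ABC.IUTFork.Joshi.Enlargements
import HarnessLib

/-!
# [J-III] §5.2 — derived rows over `PeriodRingTower` / `BEDatum` (proof-only companion of `LocalPeriodRings.lean`)

Block E (rung LADDER-ABC:A2.E), seat abc-iut-E-t9, slot T-09: K. Joshi, *Construction of Arithmetic Teichmüller Spaces III*,
arXiv:2401.13508v4 (unrefereed; bib `Joshi2024ATS3`), §5.2–§5.3, render `HOME/lit/renders/Joshi-arxiv-2401.13508/`. TAKES NO
SIDE on [IUTchIII] Cor. 3.12 or on any author; typed ≠ proved. PROOF-ONLY: no `Prop` hypothesis, no new claim; every declaration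
below FOLLOWS from the signature landed in `LocalPeriodRings.lean` (p429989) — the DERIVABLE rows of `HOME/plan/E/t9/INVENTORY.tsv`:

* `galBE` — §5.3.1 p.40 l.47–49 «the natural action of … `G_E` on `B_E`»: CONSTRUCTED (not posited) as a group homomorphism
  `G_E →* (B_E ≃ₐ[ℚ_p] B_E)` by restricting `PeriodRingTower.galΩ` (the `G`-action on `B_dR`) to `B_E = B·E ⊂ B_dR`, which `G_E`
  stabilises (`BEDatum.galΩ_mem_BE`); it FIXES `E` (`galBE_apply_of_mem_E`) and is therefore `E`-linear
  (`galBE_mul_of_mem_E`). This discharges, from the T-09 signature, the «`G_E` acts on `B_E` by `E`-linear ring automorphisms»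
  half of the hypotheses under which slot T-11 derived Thm. 6.7.1 (1) from `smul_fullEnlargement` (the «homeomorphism for the
  Fréchet topology» half needs a topology datum on `B_E` that no slot has typed).
* `mulActionBE` / `mulActionBEPi` — the corresponding `MulAction`s of `G_E` on `B_E` and on `B_E^{ℓ*} = Fin l → B_E`
  (definitions, NOT instances; bind with `letI`), so that `Joshi/Enlargements.lean`'s `twistImage` / `autEnlargement` apply
  to subsets of `B_E^{ℓ*}` verbatim as in (5.3.1.2).
* `mem_span_of_mem_BE` / `BE_le_span_finBasis` — (5.2.5.4) p.40 l.11–13 «`B̃_E = B ⊗_{ℚ_p} E` is naturally a finite and free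
  `B`-module» projected to `B_E`, and the surjectivity half of Lemma 5.2.3.1: **`B_E` is generated as a `B`-module by any
  `ℚ_p`-basis of `E`** (so by `[E:ℚ_p]` elements); PROVED from `btildeToBdR_range` (`B ⊗_{ℚ_p} E ↠ B_E`) by induction on tensors.
  (Freeness / generation by an `E_0`-basis with `[E:E_0]` elements is the CLAIM `BELinDisjoint`, not derived.)
* MERGE-DEBT MAP (plan/E/ASSIGNMENTS.md §3, batch-3 reconciliation): the §5 fields of slot T-11's `AdelicLiftDatum`
  (`galAct`, `frob`, `twist`, `subset_twist_autId`, `conv`, `toBdR`, `toBtil`) and of T-10's `ThetaLiftDatum`, per place, BUILT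
  from `(PeriodRingTower, BEDatum)`: `galAct`, `frobRingEquiv`, `twistBE`/`subset_twistBE`, `convBE` (a `ClosureOperator`),
  `val_injective_BE`, `toBtilOfSplits` (under a witness of the claim `BtildeSplits`).
bears_on: LADDER-ABC:A2.E.
-/

noncomputable section

open scoped TensorProduct

namespace Summit.ABC.IUTFork.Joshi.ATS3

namespace PeriodRingTower

variable {F B E0 : Type} [Field F] [CommRing B] [Field E0] {Y : Type} {K : Y → Type} [∀ y, Field (K y)]
  {G : Type} [Group G] {D : PeriodRingDatum F B E0 Y K G} {p : ℕ} [Fact p.Prime] [Algebra ℚ_[p] B] {Ω : Type}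
  [Field Ω] [Algebra ℚ_[p] Ω] {T : PeriodRingTower D p Ω} (ℰ : T.BEDatum)

namespace BEDatum

/-! ### `G_E ↷ B_E` constructed from `G ↷ B_dR` -/

/-- For `g ∈ G_E`, the image of `B_E` under `g` is `B_E` (both inclusions: `g` and `g⁻¹` stabilise `B_E`). [folklore] -/
theorem map_galΩ_BE (g : ℰ.GE) : (T.BE ℰ.E).map (T.galΩ g : Ω →ₐ[ℚ_[p]] Ω) = T.BE ℰ.E := by
  refine le_antisymm ?_ fun x hx => ?_
  · rintro _ ⟨x, hx, rfl⟩
    exact ℰ.galΩ_mem_BE g.2 hx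
  · refine ⟨T.galΩ (g⁻¹ : ℰ.GE) x, ℰ.galΩ_mem_BE (g⁻¹).2 hx, ?_⟩
    change T.galΩ g (T.galΩ (g⁻¹ : ℰ.GE) x) = x
    rw [← AlgEquiv.mul_apply, ← map_mul, Subgroup.coe_inv, mul_inv_cancel, map_one, AlgEquiv.one_apply]

/-- [J-III] §5.3.1 p.40 l.47–49 «the natural action of … `G_E` on `B_E`»: the element `g ∈ G_E` acting on `B_E` as a
`ℚ_p`-algebra automorphism — the RESTRICTION of `galΩ g`. CONSTRUCTED. [claim: Joshi2024ATS3, status: disputed] -/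
def galBEAux (g : ℰ.GE) : T.BE ℰ.E ≃ₐ[ℚ_[p]] T.BE ℰ.E :=
  ((T.galΩ g).subalgebraMap (T.BE ℰ.E)).trans (Subalgebra.equivOfEq _ _ (ℰ.map_galΩ_BE g))

/-- `galBEAux g` acts as `galΩ g` on underlying elements of `B_dR`. [folklore] -/
@[simp] theorem coe_galBEAux (g : ℰ.GE) (x : T.BE ℰ.E) : ((ℰ.galBEAux g x : T.BE ℰ.E) : Ω) = T.galΩ g x := rfl

/-- **The action `G_E →* Aut_{ℚ_p-alg}(B_E)`** (§5.3.1), as a group homomorphism. CONSTRUCTED. [claim: Joshi2024ATS3, status: disputed] -/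
def galBE : ℰ.GE →* (T.BE ℰ.E ≃ₐ[ℚ_[p]] T.BE ℰ.E) where
  toFun := ℰ.galBEAux
  map_one' := by
    ext x
    rw [coe_galBEAux, Subgroup.coe_one, map_one, AlgEquiv.one_apply, AlgEquiv.one_apply]
  map_mul' g h := by
    ext x
    rw [coe_galBEAux, Subgroup.coe_mul, map_mul, AlgEquiv.mul_apply, AlgEquiv.mul_apply, coe_galBEAux, coe_galBEAux]

/-- `galBE g` acts as `galΩ g` on underlying elements. [folklore] -/
@[simp] theorem coe_galBE (g : ℰ.GE) (x : T.BE ℰ.E) : ((ℰ.galBE g x : T.BE ℰ.E) : Ω) = T.galΩ g x := rfl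

/-- `G_E` fixes `E ⊂ B_E` pointwise. [folklore] -/
theorem galBE_apply_of_mem_E (g : ℰ.GE) {e : Ω} (he : e ∈ ℰ.E) :
    ℰ.galBE g ⟨e, T.mem_BE_of_mem ℰ.E he⟩ = ⟨e, T.mem_BE_of_mem ℰ.E he⟩ :=
  Subtype.ext (by rw [coe_galBE]; exact g.2 e he)

/-- Hence the action is `E`-LINEAR: `g(e·x) = e·g(x)` for `e ∈ E`, `x ∈ B_E` («G_E acts on B_E = B ⊗_{E_0} E through B»,
the first hypothesis of T-11's derivation of Thm. 6.7.1 (1), discharged over the T-09 signature). [folklore] -/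
theorem galBE_mul_of_mem_E (g : ℰ.GE) {e : Ω} (he : e ∈ ℰ.E) (x : T.BE ℰ.E) :
    ℰ.galBE g (⟨e, T.mem_BE_of_mem ℰ.E he⟩ * x) = ⟨e, T.mem_BE_of_mem ℰ.E he⟩ * ℰ.galBE g x := by
  rw [map_mul, ℰ.galBE_apply_of_mem_E g he]

/-- `G_E` acts compatibly with E-t3's action on `B`: `g(ι b) = ι(D.gal g b)`. [folklore] -/
theorem galBE_toBdR (g : ℰ.GE) (b : B) :
    ((ℰ.galBE g ⟨T.toBdR b, T.toBdR_mem_BE ℰ.E b⟩ : T.BE ℰ.E) : Ω) = T.toBdR (D.gal g b) := by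
  rw [coe_galBE, T.galΩ_toBdR]

/-- The `G_E`-action on `B_E` as a `MulAction` — a DEFINITION to be bound with `letI`, not an instance (typer lint). With it,
`Joshi/Enlargements.lean`'s `saturation` / `twistImage` / `autEnlargement` apply to subsets of `B_E`. [folklore] -/
abbrev mulActionBE : MulAction ℰ.GE (T.BE ℰ.E) := MulAction.compHom (T.BE ℰ.E) ℰ.galBE

/-- Unfolding: `g • x = galBE g x`. [folklore] -/
theorem mulActionBE_smul (g : ℰ.GE) (x : T.BE ℰ.E) : (letI := ℰ.mulActionBE; g • x) = ℰ.galBE g x := rfl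

/-- The diagonal `G_E`-action on `B_E^{ℓ*} = Fin l → B_E` ((5.3.1.2) «applied verbatim to … `B_E^{ℓ*}`»), a DEFINITION
(Mathlib's `Pi.mulAction` over `mulActionBE`). [folklore] -/
abbrev mulActionBEPi (l : ℕ) : MulAction ℰ.GE (Fin l → T.BE ℰ.E) :=
  letI := ℰ.mulActionBE; inferInstance

/-- Unfolding: `(g • z) i = galBE g (z i)`. [folklore] -/
theorem mulActionBEPi_smul (l : ℕ) (g : ℰ.GE) (z : Fin l → T.BE ℰ.E) (i : Fin l) :
    (letI := ℰ.mulActionBEPi l; (g • z) i) = ℰ.galBE g (z i) := rfl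

/-! ### `B_E` is a finitely generated `B`-module ((5.2.5.4); surjectivity half of Lemma 5.2.3.1) -/

/-- Every element of `B_E` lies in the `B`-span (scalars: the subring `ι(B) ⊂ B_dR`) of `E`. PROVED from
`btildeToBdR_range` by induction on tensors. [folklore] -/
theorem mem_span_of_mem_BE {x : Ω} (hx : x ∈ T.BE ℰ.E) :
    x ∈ Submodule.span T.toBdR.range (ℰ.E : Set Ω) := by
  rw [← ℰ.btildeToBdR_range] at hx
  obtain ⟨z, rfl⟩ := hx
  change ℰ.btildeToBdR z ∈ _
  induction z using TensorProduct.induction_on with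
  | zero => rw [map_zero]; exact Submodule.zero_mem _
  | tmul b e =>
      rw [BEDatum.btildeToBdR, Algebra.TensorProduct.productMap_apply_tmul]
      have h : T.toBdR b * (ℰ.E.val e) = (⟨T.toBdR b, ⟨b, rfl⟩⟩ : T.toBdR.range) • (e : Ω) := rfl
      rw [h]
      exact Submodule.smul_mem _ _ (Submodule.subset_span e.2)
  | add x y hx hy => rw [map_add]; exact Submodule.add_mem _ hx hy

/-- `ℚ_p ⊂ ι(B)` inside `B_dR` (the structure map of the `ℚ_p`-algebra `B`). [folklore] -/
theorem algebraMap_mem_range (c : ℚ_[p]) : algebraMap ℚ_[p] Ω c ∈ T.toBdR.range :=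
  ⟨algebraMap ℚ_[p] B c, T.toBdR.commutes c⟩

/-- **`B_E` is generated as a `B`-module by a `ℚ_p`-basis of `E`** (finitely many generators, `[E:ℚ_p]` of them):
(5.2.5.4) «a finite … `B`-module», surjectivity half of Lemma 5.2.3.1. PROVED. [folklore] -/
theorem BE_le_span_finBasis :
    letI := ℰ.finiteDimensional
    (T.BE ℰ.E : Set Ω) ⊆ Submodule.span T.toBdR.range
      (Set.range fun i => ((Module.finBasis ℚ_[p] ℰ.E i : ℰ.E) : Ω)) := by
  letI := ℰ.finiteDimensional
  intro x hx
  set bE := Module.finBasis ℚ_[p] ℰ.E with hbE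
  -- it suffices to put `E` inside the span of the basis vectors (with `B`-coefficients)
  suffices hE : (ℰ.E : Set Ω) ⊆ Submodule.span T.toBdR.range (Set.range fun i => ((bE i : ℰ.E) : Ω)) by
    exact Submodule.span_le.2 hE (ℰ.mem_span_of_mem_BE hx)
  intro e he
  have hsum : (∑ i, (bE.repr ⟨e, he⟩ i) • ((bE i : ℰ.E) : Ω)) = e := by
    have := congrArg (fun y : ℰ.E => (y : Ω)) (bE.sum_repr ⟨e, he⟩)
    simpa only [IntermediateField.coe_sum, IntermediateField.coe_smul] using this
  rw [← hsum]
  refine Submodule.sum_mem _ fun i _ => ?_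
  have h : (bE.repr ⟨e, he⟩ i) • ((bE i : ℰ.E) : Ω) =
      (⟨algebraMap ℚ_[p] Ω (bE.repr ⟨e, he⟩ i), algebraMap_mem_range (T := T) _⟩ : T.toBdR.range) • ((bE i : ℰ.E) : Ω) := by
    rw [Algebra.smul_def]; rfl
  rw [h]
  exact Submodule.smul_mem _ _ (Submodule.subset_span ⟨i, rfl⟩)

/-! ### Merge-debt map (ASSIGNMENTS §3): the §5 fields of slot T-11's `AdelicLiftDatum` / T-10's `ThetaLiftDatum`, per place,
BUILT from the T-09 carriers — `galAct`, `frob`, `AutG`/`autId`/`twist`/`subset_twist_autId`, `conv`, `BdR`/`toBdR`,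
`Btil`/`toBtil` (the last under a witness of the claim `BtildeSplits`). Definitions + their defining properties only. -/

/-- `galAct` of slot T-11 at this place: `g ∈ G_E` as a ring automorphism of `B_E`. [folklore] -/
abbrev galAct (g : ℰ.GE) : T.BE ℰ.E ≃+* T.BE ℰ.E := (ℰ.galBE g).toRingEquiv

/-- `frob` of slot T-11 at this place: the Frobenius of `B_E` as a ring automorphism (the field `frobBE`). [folklore] -/
abbrev frobRingEquiv : T.BE ℰ.E ≃+* T.BE ℰ.E := ℰ.frobBE.toRingEquiv

/-- `twist` of slot T-11 at this place, in the literal reading R1 of (5.3.1.1)–(5.3.1.2): `S ↦ S^σ` for `σ ∈ Aut(G_E)` on subsets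
of `B_E^{ℓ*}` = `Joshi/Enlargements.lean`'s `twistImage` for the diagonal `G_E`-action `mulActionBEPi`. [claim: Joshi2024ATS3, status: disputed] -/
def twistBE (l : ℕ) (σ : MulAut ℰ.GE) (S : Set (Fin l → T.BE ℰ.E)) : Set (Fin l → T.BE ℰ.E) :=
  letI := ℰ.mulActionBEPi l; twistImage σ S

/-- `subset_twist_autId` of slot T-11: `S ⊆ S^{id}` (indeed `S^σ = G_E·S ⊇ S` for every `σ`, T-09's `twistImage_eq_saturation`).
[folklore] -/
theorem subset_twistBE (l : ℕ) (σ : MulAut ℰ.GE) (S : Set (Fin l → T.BE ℰ.E)) : S ⊆ ℰ.twistBE l σ S := by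
  letI := ℰ.mulActionBEPi l
  unfold twistBE
  rw [twistImage_eq_saturation]
  exact subset_saturation S

/-- `conv` of slot T-11 at this place: the closed convex hull of §5.3.3 (`Joshi/Enlargements.lean`'s `closedConvexHull`) as a
Mathlib `ClosureOperator` on subsets of `B_E^{ℓ*}`, for any topology on `B_E` (the Fréchet topology is not typed by any slot)
and any ring of scalars `O` acting on `B_E` (use `O = 𝒪_E`). [folklore] -/
def convBE (O : Type*) [CommRing O] [Module O (T.BE ℰ.E)] [TopologicalSpace (T.BE ℰ.E)] (l : ℕ) :
    ClosureOperator (Set (Fin l → T.BE ℰ.E)) :=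
  ClosureOperator.ofPred (closedConvexHull O) (fun A => IsClosed A ∧ LogVol.IsConvexNA O A)
    (subset_closedConvexHull O) (fun S => ⟨isClosed_closedConvexHull O S, isConvexNA_closedConvexHull O S⟩)
    (fun _ _ hST hT => closedConvexHull_minimal O hST hT.1 hT.2)

/-- `convBE` IS `closedConvexHull`. [folklore] -/
theorem convBE_apply (O : Type*) [CommRing O] [Module O (T.BE ℰ.E)] [TopologicalSpace (T.BE ℰ.E)] (l : ℕ)
    (S : Set (Fin l → T.BE ℰ.E)) : ℰ.convBE O l S = closedConvexHull O S := rfl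

/-- `BdR`/`toBdR` of slot T-11 at this place: `B_E ↪ B_dR = Ω` is the subtype inclusion, injective BY DESIGN ((5.2.4.1)). [folklore] -/
theorem val_injective_BE : Function.Injective (fun x : T.BE ℰ.E => (x : Ω)) := Subtype.val_injective

/-- `Btil`/`toBtil` of slot T-11 at this place: under a witness `e` of the claim (5.2.5.4) `BtildeSplits`, the diagonal
embedding (5.2.5.5) `B_E ↪ B̃_E = B ⊗_{ℚ_p} E`, `x ↦ e⁻¹(x, …, x)`. [claim: Joshi2024ATS3, status: disputed] -/
def toBtilOfSplits (e : ℰ.Btilde ≃ₐ[ℚ_[p]] (Fin ℰ.f → T.BE ℰ.E)) : T.BE ℰ.E →ₐ[ℚ_[p]] ℰ.Btilde :=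
  (e.symm : (Fin ℰ.f → T.BE ℰ.E) →ₐ[ℚ_[p]] ℰ.Btilde).comp (Pi.constAlgHom ℚ_[p] (Fin ℰ.f) (T.BE ℰ.E))

/-- `e ∘ toBtil` is the diagonal `x ↦ (x, …, x)`. [folklore] -/
theorem apply_toBtilOfSplits (e : ℰ.Btilde ≃ₐ[ℚ_[p]] (Fin ℰ.f → T.BE ℰ.E)) (x : T.BE ℰ.E) :
    e (ℰ.toBtilOfSplits e x) = fun _ => x := by
  change e (e.symm fun _ => x) = _
  exact e.apply_symm_apply _

/-- The diagonal embedding is injective as soon as `[E_0 : ℚ_p] ≠ 0` (i.e. `Fin ℰ.f` is nonempty). [folklore] -/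
theorem toBtilOfSplits_injective (e : ℰ.Btilde ≃ₐ[ℚ_[p]] (Fin ℰ.f → T.BE ℰ.E)) (hf : ℰ.f ≠ 0) :
    Function.Injective (ℰ.toBtilOfSplits e) := by
  intro x y hxy
  have h : (fun _ : Fin ℰ.f => x) = fun _ => y := by
    rw [← ℰ.apply_toBtilOfSplits e x, ← ℰ.apply_toBtilOfSplits e y, hxy]
  exact congrFun h ⟨0, Nat.pos_of_ne_zero hf⟩

end BEDatum

end PeriodRingTower

end Summit.ABC.IUTFork.Joshi.ATS3

end
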